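import Mathlib.Data.Nat.Choose.Basic
import Mathlib.Data.Finset.Powerset
import Mathlib.Data.Fintype.Powerset
import Mathlib.Analysis.SpecialFunctions.Exp
import Mathlib.Tactic.FieldSimp
import Mathlib.Tactic.GCongr
import Mathlib.Tactic.Positivity
import HarnessLib

/-!
# Random subsets hit large sets (the hitting property used in direct-product decoding)

Trunk T-CPLX-CORE, companion of `SamplingChernoff.lean`. The only "sampler" property of the
`S`-graph used by Impagliazzo–Jaiswal–Kabanets–Wigderson in the proof that excellent edges are
abundant (2010, Lemma 3.11, footnote 6: "we need only that, for any measure `μ` subset `F` of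
left vertices of `H`, the fraction of right vertices with no incident edges into `F` is at most
`ν(μ)`") is, for the `k`-tuple / random-position-subset version planned for
`Literature.Computability.Learning.cikk_natural_implies_learning`, the elementary fact that a uniformly random
`s`-subset of `[k]` avoids a fixed set `E` with probability `C(k-|E|, s)/C(k, s) ≤ (1 - |E|/k)^s
≤ exp(-s|E|/k)`. Counting form; everything proved.

* `card_powersetCard_filter_disjoint` — `#{P ⊆ univ : |P| = s, P ∩ E = ∅} = C(|α| - |E|, s)`;
* `choose_sub_le_pow_mul_choose` — `C(k - e, s) ≤ (1 - e/k)^s · C(k, s)` (`e ≤ k`, `0 < k`);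
* `card_avoiding_le_exp` — hence `#{P : P ∩ E = ∅} ≤ exp(-s|E|/k) · C(k, s)`.

## References

* R. Impagliazzo, R. Jaiswal, V. Kabanets, A. Wigderson, *Uniform direct product theorems:
  simplified, optimized, and derandomized*, SIAM J. Comput. 39 (2010), Lemma 3.11 and
  footnote 6; Lemma 2.1 (Hoeffding for random subsets, of which this is the `μ`-vs-`0` case)
  [ImpagliazzoEtAl2010].
-/

namespace Literature.Computability.Complexity

open Finset Real

/-- The `s`-subsets of a finite type avoiding `E` are the `s`-subsets of `Eᶜ`:
there are `C(|α| - |E|, s)` of them. [folklore] -/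
theorem card_powersetCard_filter_disjoint {α : Type*} [Fintype α] [DecidableEq α]
    (E : Finset α) (s : ℕ) :
    ((univ.powersetCard s).filter fun P => Disjoint P E).card =
      (Fintype.card α - E.card).choose s := by
  have : ((univ.powersetCard s).filter fun P => Disjoint P E) = (univ \ E).powersetCard s := by
    ext P
    simp only [mem_filter, mem_powersetCard, subset_univ, true_and, subset_sdiff,
      and_comm]
  rw [this, card_powersetCard, card_sdiff_of_subset (subset_univ E), card_univ]

/-- `C(k - e, s) ≤ (1 - e/k)^s · C(k, s)` for `e ≤ k`, `0 < k`: term by term,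
`(k-e-i)/(k-i) ≤ (k-e)/k`. [folklore] -/
theorem choose_sub_le_pow_mul_choose {k e : ℕ} (hk : 0 < k) (he : e ≤ k) (s : ℕ) :
    ((k - e).choose s : ℝ) ≤ (1 - (e : ℝ) / k) ^ s * (k.choose s) := by
  have hk' : (0 : ℝ) < k := Nat.cast_pos.2 hk
  have hq : (1 - (e : ℝ) / k) = ((k - e : ℕ) : ℝ) / k := by
    rw [Nat.cast_sub he]; field_simp
  rw [hq]
  induction s with
  | zero => simp
  | succ s ih =>
    -- `C(m, s+1) (s+1) = C(m, s) (m - s)` for `m = k - e` and `m = k`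
    have h1 := Nat.choose_succ_right_eq (k - e) s
    have h2 := Nat.choose_succ_right_eq k s
    have hs1 : (0 : ℝ) < s + 1 := by positivity
    -- pass to `ℝ`
    have h1r : (((k - e).choose (s + 1) : ℕ) : ℝ) * (s + 1) =
        ((k - e).choose s : ℕ) * ((k - e - s : ℕ) : ℝ) := by exact_mod_cast h1
    have h2r : ((k.choose (s + 1) : ℕ) : ℝ) * (s + 1) = (k.choose s : ℕ) * ((k - s : ℕ) : ℝ) := by
      exact_mod_cast h2
    rcases le_or_gt (s + 1) (k - e) with hle | hlt
    · -- the generic case: all subtractions are genuine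
      have hsk : s ≤ k := by omega
      have hse : s ≤ k - e := by omega
      have e1 : ((k - e - s : ℕ) : ℝ) = (k : ℝ) - e - s := by
        rw [Nat.cast_sub hse, Nat.cast_sub he]
      have e2 : ((k - s : ℕ) : ℝ) = (k : ℝ) - s := by rw [Nat.cast_sub hsk]
      rw [e1] at h1r
      rw [e2] at h2r
      have hks : (0 : ℝ) < (k : ℝ) - s := by
        have : (s : ℝ) + 1 ≤ k := by exact_mod_cast (by omega : s + 1 ≤ k)
        linarith
      -- divide the recurrences
      have eq1 : (((k - e).choose (s + 1) : ℕ) : ℝ) =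
          ((k - e).choose s : ℕ) * ((k : ℝ) - e - s) / (s + 1) := by
        rw [eq_div_iff hs1.ne', h1r]
      have eq2 : ((k.choose (s + 1) : ℕ) : ℝ) = (k.choose s : ℕ) * ((k : ℝ) - s) / (s + 1) := by
        rw [eq_div_iff hs1.ne', h2r]
      rw [eq1, eq2, pow_succ]
      have hke : (0 : ℝ) ≤ ((k - e : ℕ) : ℝ) := Nat.cast_nonneg _
      have hratio : ((k : ℝ) - e - s) ≤ ((k - e : ℕ) : ℝ) / k * ((k : ℝ) - s) := by
        rw [Nat.cast_sub he, div_mul_eq_mul_div, le_div_iff₀ hk']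
        have hes : (0 : ℝ) ≤ (e : ℝ) * s := by positivity
        nlinarith
      have hnum : (0 : ℝ) ≤ (k : ℝ) - e - s := by
        have : (s : ℝ) + 1 ≤ ((k - e : ℕ) : ℝ) := by exact_mod_cast hle
        rw [Nat.cast_sub he] at this
        linarith
      have hprod := mul_le_mul ih hratio hnum (by positivity)
      calc (((k - e).choose s : ℕ) : ℝ) * ((k : ℝ) - e - s) / (s + 1)
          ≤ ((((k - e : ℕ) : ℝ) / k) ^ s * (k.choose s : ℕ)) *
              (((k - e : ℕ) : ℝ) / k * ((k : ℝ) - s)) / (s + 1) :=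
            div_le_div_of_nonneg_right hprod hs1.le
          _ = _ := by ring
    · -- `s + 1 > k - e`: the left-hand side vanishes
      rw [Nat.choose_eq_zero_of_lt hlt, Nat.cast_zero]
      positivity

/-- **A random `s`-subset avoids `E` with probability at most `exp(-s|E|/|α|)`** (counting
form: the avoiding `s`-subsets number at most `exp(-s|E|/|α|) · C(|α|, s)`), the hitting
property used for IJKW Lemma 3.11. [folklore] -/
theorem card_avoiding_le_exp {α : Type*} [Fintype α] [DecidableEq α] [Nonempty α]
    (E : Finset α) (s : ℕ) :
    (((univ.powersetCard s).filter fun P => Disjoint P E).card : ℝ) ≤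
      exp (-(s * E.card / Fintype.card α : ℝ)) * (Fintype.card α).choose s := by
  rw [card_powersetCard_filter_disjoint]
  have hk : 0 < Fintype.card α := Fintype.card_pos
  have he : E.card ≤ Fintype.card α := by
    simpa using card_le_univ E
  refine (choose_sub_le_pow_mul_choose hk he s).trans
    (mul_le_mul_of_nonneg_right ?_ (by positivity))
  have h1 : (1 - (E.card : ℝ) / Fintype.card α) ≤ exp (-((E.card : ℝ) / Fintype.card α)) :=
    Real.one_sub_le_exp_neg _
  have h0 : (0 : ℝ) ≤ 1 - (E.card : ℝ) / Fintype.card α := by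
    rw [sub_nonneg, div_le_one (by exact_mod_cast hk)]
    exact_mod_cast he
  calc (1 - (E.card : ℝ) / Fintype.card α) ^ s ≤ (exp (-((E.card : ℝ) / Fintype.card α))) ^ s :=
        pow_le_pow_left₀ h0 h1 s
    _ = exp (-(s * E.card / Fintype.card α : ℝ)) := by
        rw [← Real.exp_nat_mul]; congr 1; ring

end Literature.Computability.Complexity
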